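import Mathlib
import HarnessLib
import Literature.Probability.LatticeModels.TorusFourierAdditiveTimeMoment
import Literature.MathematicalPhysics.QuantumLattice.HubbardScaleZeroSectorSymbolTimeHigher
import Summits.HubbardSuperconductivity.HubbardSuperconductivity.Theorems.KLProgrammeKLRegimeEngineScaleZeroExplicit

/-!
# K3 engine child, stub `stub_engine_scale0`, clause (E4)₀: the TIME MOMENT `T_T` of the scale-`0` multiplier kernels, part 1 —
# the time torus sum from symbol data (abstract multiplier family)

Cell `gate-hubbard-kl`, seat p4 (C5a lead; multiplier lane), g8.  k3c2-p1's (E4)₀ assembly `…ScaleZeroE4TorusSums.firstMoment_zero_le_of_torusSums`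
reads the first space–time moment of the scale-`0` quartic kernel through ONE weighted product-torus sum of the multiplier character sums
(hypothesis `hT`, weight `1 + (β/4M)·cyclicDist(d) + torusSiteDist(w⃗)`).  By linearity `T_w = T₀ + T_T + T_X`; `T₀` is
`torusSum_le_of_symbol_bounds` (…ScaleZeroOverlapL1).  Here the TIME part `T_T` (the `(β/4M)·cyclicDist` term) from symbol data, with NO mixed
differences: Cauchy–Schwarz with the additive weight `1 + (s₀|d̃|)¹² + Σ_i (s₁|w̃_i|)⁴` and the monomial `(β/4M)|d̃|`
(`TorusFourierAdditiveTimeMoment.sum_sum_mul_norm_prodChar_le_additive`, weight sum `sum_timeMomentWeight_le`), pure SIXTH time differences and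
pure SECOND axis differences of the padded symbol (`HubbardScaleZeroSectorSymbolTimeHigher.sum_norm_sq_fwdDiff_iter_le`):

* `fwdDiff_iter_prod_fst` / `fwdDiff_iter_prod_snd` — product-torus differences along `(u,0)` / `(0,v)` are the one-factor differences;
* **`timeTorusSum_le_of_symbol_bounds`** — for a real family `F`, `‖F‖ ≤ 1`, padded support `≤ N_s`, sixth time differences `≤ A₆`, axis second
  differences `≤ (4/(s₁L))²`, and any rate `s₀ > 0`:
  `(|β|L²)⁻¹ Σ_{dw} (β/4M)·cyclicDist(dw.1 0, 0)·‖Σ_k F_ω(k) Χ_c(k;dw)‖ ≤ (|β|L²)⁻¹·√((β/(4M·s₀))²·(4 + 2π/s₀)(2 + 12/s₁)²)·√(4M·L²·N_s·(7 + 7·(s₀·4M/4)¹²·A₆²))`.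

The instantiation on the scale-`0` family `klAnisoFamily … klE0 0` (rate `s₀ = klE0·β/(π·4M)`, so that `(s₀·4M/4)·(2π/β)·(2/klE0) = 1` and every
`β` of the time differences cancels; result `T_T ≤ C_T·M/β`) is part 2, `…ScaleZeroE4OverlapTimeExplicit.lean`.
Everything is proved; no definitions, no named facts, no sorry. [cite: BenfattoGiulianiMastropietro2006, Lemma 2.2 (2.36aa), §2.8 (2.81), (3.3)]
-/

noncomputable section

namespace Summit.HubbardSuperconductivity.HubbardSuperconductivity.Theorems.EngineV8

set_option linter.dupNamespace false -- summit = problem name (single-conjunct summit), D-0017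

open Real Finset Literature.MathematicalPhysics.QuantumLattice Literature.Probability.LatticeModels
open Summit.HubbardSuperconductivity.HubbardSuperconductivity.Theorems.KLRegimeSplit
open Summit.HubbardSuperconductivity.HubbardSuperconductivity.Theorems.KLProgrammeLegKernels
open scoped ComplexConjugate Nat

variable {L : ℕ} {Ng : ℕ}

/-! ## §1 Product-torus differences along one factor -/

/-- A product-torus difference along `(u, 0)` is the first-factor difference. -/
theorem fwdDiff_iter_prod_fst (G : TorusSite 1 Ng × TorusSite 2 L → ℂ) (u : TorusSite 1 Ng) (n : ℕ) (q : TorusSite 1 Ng × TorusSite 2 L) :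
    (fwdDiff (u, (0 : TorusSite 2 L)))^[n] G q = (fwdDiff u)^[n] (fun p => G (p, q.2)) q.1 := by
  have hs : ∀ k ≤ n, G (q + k • (u, (0 : TorusSite 2 L))) = (1 : ℝ) • (fun p => G (p, q.2)) (q.1 + k • u) := by
    intro k _
    obtain ⟨q₁, q₂⟩ := q
    simp [Prod.smul_mk]
  rw [Literature.Analysis.fwdDiff_iter_eq_smul_of_sample (R := ℝ) (K := (1 : ℝ)) (n := n) (G := G) (f := fun p => G (p, q.2))
    (y' := q) (y := q.1) (h' := (u, (0 : TorusSite 2 L))) (h := u) hs, one_smul]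

/-- A product-torus difference along `(0, v)` is the second-factor difference. -/
theorem fwdDiff_iter_prod_snd (G : TorusSite 1 Ng × TorusSite 2 L → ℂ) (v : TorusSite 2 L) (n : ℕ) (q : TorusSite 1 Ng × TorusSite 2 L) :
    (fwdDiff ((0 : TorusSite 1 Ng), v))^[n] G q = (fwdDiff v)^[n] (fun p' => G (q.1, p')) q.2 := by
  have hs : ∀ k ≤ n, G (q + k • ((0 : TorusSite 1 Ng), v)) = (1 : ℝ) • (fun p' => G (q.1, p')) (q.2 + k • v) := by
    intro k _
    obtain ⟨q₁, q₂⟩ := q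
    simp [Prod.smul_mk]
  rw [Literature.Analysis.fwdDiff_iter_eq_smul_of_sample (R := ℝ) (K := (1 : ℝ)) (n := n) (G := G) (f := fun p' => G (q.1, p'))
    (y' := q) (y := q.2) (h' := ((0 : TorusSite 1 Ng), v)) (h := v) hs, one_smul]

/-- The cyclic distance to `0` on `ℤ/n` is the size of the centred representative. -/
theorem cyclicDist_zero_eq_abs_valMinAbs {n : ℕ} [NeZero n] (a : ZMod n) :
    cyclicDist n a 0 = |((a.valMinAbs : ℤ) : ℝ)| := by
  rw [cyclicDist, sub_zero, ← ZMod.valMinAbs_natAbs_eq_min, Nat.cast_natAbs, Int.cast_abs]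

/-! ## §2 The time torus sum from symbol data -/

variable [NeZero L] {M : ℕ} {Ns : ℕ}

/-- **The time part of the weighted torus sum from symbol data** (see the module docstring).
[cite: BenfattoGiulianiMastropietro2006, Lemma 2.2 (2.36aa) and (3.3)] -/
theorem timeTorusSum_le_of_symbol_bounds [NeZero M] {β : ℝ} (hβ : 0 < β) (F : Fin Ns → FreqMomentum L M → ℂ)
    (hreal : ∀ ω k, conj (F ω k) = F ω k) (hF1 : ∀ ω k, ‖F ω k‖ ≤ 1)
    {s₀ s₁ : ℝ} (hs₀ : 0 < s₀) (hs₁ : 0 < s₁) {Nsupp : ℕ}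
    (hsupp : ∀ ω, (univ.filter fun q : TorusSite 1 (2 * (2 * M)) × TorusSite 2 L =>
      (if h : (q.1 0).val < 2 * M then F ω (⟨(q.1 0).val, h⟩, q.2) else 0) ≠ 0).card ≤ Nsupp)
    {A₆ : ℝ}
    (h₆ : ∀ ω q, ‖(fwdDiff ((fun _ : Fin 1 => (1 : ZMod (2 * (2 * M)))), (0 : TorusSite 2 L)))^[6]
      (fun q : TorusSite 1 (2 * (2 * M)) × TorusSite 2 L =>
        if h : (q.1 0).val < 2 * M then F ω (⟨(q.1 0).val, h⟩, q.2) else 0) q‖ ≤ A₆)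
    (h₁ : ∀ ω q (i : Fin 2), ‖(fwdDiff ((0 : TorusSite 1 (2 * (2 * M))), (Pi.single i (1 : ZMod L) : TorusSite 2 L)))^[2]
      (fun q : TorusSite 1 (2 * (2 * M)) × TorusSite 2 L =>
        if h : (q.1 0).val < 2 * M then F ω (⟨(q.1 0).val, h⟩, q.2) else 0) q‖ ≤ (4 / (s₁ * L)) ^ 2)
    (ω : Fin Ns) (c : Fin 2) :
    1 / (|β| * (L : ℝ) ^ 2) *
        ∑ dw : TorusSite 1 (2 * (2 * M)) × TorusSite 2 L,
          (β / (2 * (2 * M) : ℕ) * cyclicDist (2 * (2 * M)) (dw.1 0) 0) *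
            ‖∑ k : FreqMomentum L M, F ω k *
              (if c = 0 then torusChar (fun _ : Fin 1 => ((k.1 : ℕ) : ZMod (2 * (2 * M)))) dw.1 * torusChar k.2 dw.2
                else conj (torusChar (fun _ : Fin 1 => ((k.1 : ℕ) : ZMod (2 * (2 * M)))) dw.1 * torusChar k.2 dw.2))‖ ≤
      1 / (|β| * (L : ℝ) ^ 2) *
        (Real.sqrt ((β / (((2 * (2 * M) : ℕ) : ℝ) * s₀)) ^ 2 * ((4 + 2 * Real.pi / s₀) * (2 + 12 / s₁) ^ 2)) *
          Real.sqrt (((2 * (2 * M) : ℕ) : ℝ) * (L : ℝ) ^ 2 *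
            (Nsupp * (7 + 7 * (s₀ * ((2 * (2 * M) : ℕ) : ℝ) / 4) ^ 12 * A₆ ^ 2)))) := by
  classical
  haveI hNz : NeZero (2 * (2 * M)) := ⟨by have := NeZero.ne M; omega⟩
  have hNgpos : (0 : ℝ) < ((2 * (2 * M) : ℕ) : ℝ) := by exact_mod_cast Nat.pos_of_ne_zero hNz.ne
  have hL : (0 : ℝ) < L := by exact_mod_cast Nat.pos_of_ne_zero (NeZero.ne L)
  refine mul_le_mul_of_nonneg_left ?_ (by positivity)
  -- the padded symbol
  set G : TorusSite 1 (2 * (2 * M)) × TorusSite 2 L → ℂ := fun q =>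
    if h : (q.1 0).val < 2 * M then F ω (⟨(q.1 0).val, h⟩, q.2) else 0 with hG
  have hsup : ∀ q, ‖G q‖ ≤ 1 := fun q => by
    rw [hG]
    dsimp only
    split_ifs
    · exact hF1 ω _
    · rw [norm_zero]; exact zero_le_one
  -- each summand: the conjugate orientation has the same size, and the character sum is the padded curried one
  have hkey : ∀ dw : TorusSite 1 (2 * (2 * M)) × TorusSite 2 L, ‖∑ k : FreqMomentum L M, F ω k *
      (if c = 0 then torusChar (fun _ : Fin 1 => ((k.1 : ℕ) : ZMod (2 * (2 * M)))) dw.1 * torusChar k.2 dw.2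
        else conj (torusChar (fun _ : Fin 1 => ((k.1 : ℕ) : ZMod (2 * (2 * M)))) dw.1 * torusChar k.2 dw.2))‖ =
      ‖∑ p : TorusSite 1 (2 * (2 * M)), ∑ p' : TorusSite 2 L, torusChar p dw.1 * torusChar p' dw.2 * (fun a b => G (a, b)) p p'‖ := by
    intro dw
    have h1 : ‖∑ k : FreqMomentum L M, F ω k *
        (if c = 0 then torusChar (fun _ : Fin 1 => ((k.1 : ℕ) : ZMod (2 * (2 * M)))) dw.1 * torusChar k.2 dw.2
          else conj (torusChar (fun _ : Fin 1 => ((k.1 : ℕ) : ZMod (2 * (2 * M)))) dw.1 * torusChar k.2 dw.2))‖ =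
        ‖∑ k : FreqMomentum L M, F ω k * (torusChar (fun _ : Fin 1 => ((k.1 : ℕ) : ZMod (2 * (2 * M)))) dw.1 * torusChar k.2 dw.2)‖ := by
      by_cases hc0 : c = 0
      · simp only [hc0, if_true]
      · simp only [hc0, if_false]
        exact norm_charSum_conj_eq F hreal ω dw.1 dw.2
    rw [h1, charSum_freqMomentum_eq_charSum_padded F ω, Fintype.sum_prod_type]
    rfl
  have hwt : ∀ dw : TorusSite 1 (2 * (2 * M)) × TorusSite 2 L,
      β / (2 * (2 * M) : ℕ) * cyclicDist (2 * (2 * M)) (dw.1 0) 0 = β / (2 * (2 * M) : ℕ) * |(((dw.1 0).valMinAbs : ℤ) : ℝ)| := by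
    intro dw; rw [cyclicDist_zero_eq_abs_valMinAbs]
  simp_rw [hkey, hwt]
  rw [Fintype.sum_prod_type]
  -- Cauchy–Schwarz with the additive weight, orders `(6, 2)`
  set c₀ : ℝ := (s₀ * ((2 * (2 * M) : ℕ) : ℝ) / 4) ^ 12 with hc₀
  set c₁ : ℝ := (s₁ * L / 4) ^ 4 with hc₁
  have hc₀0 : 0 ≤ c₀ := by positivity
  have hc₁0 : 0 ≤ c₁ := by positivity
  have hCS := sum_sum_mul_norm_prodChar_le_additive (d₁ := 1) (L₁ := 2 * (2 * M)) (d₂ := 2) (L₂ := L) (univ : Finset (Fin 2))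
    (fun _ : Fin 1 => (1 : ZMod (2 * (2 * M)))) c₀ hc₀0 (fun i : Fin 2 => (Pi.single i (1 : ZMod L) : TorusSite 2 L)) (fun _ => c₁)
    (fun _ _ => hc₁0) 6 2 (fun a _ => β / (2 * (2 * M) : ℕ) * |(((a 0).valMinAbs : ℤ) : ℝ)|) (fun a b => by positivity)
    (fun a b => G (a, b))
  have e1 : ∀ a : TorusSite 1 (2 * (2 * M)), (∑ j, (fun _ : Fin 1 => (1 : ZMod (2 * (2 * M)))) j * a j) = a 0 := fun a => by simp
  have e2 : ∀ (i : Fin 2) (b : TorusSite 2 L), (∑ j, (Pi.single i (1 : ZMod L) : TorusSite 2 L) j * b j) = b i := by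
    intro i b; simp [Pi.single_apply]
  simp only [e1, e2] at hCS
  refine hCS.trans (mul_le_mul ?_ ?_ (Real.sqrt_nonneg _) (Real.sqrt_nonneg _))
  · -- the inverse-weight sum with the squared monomial
    refine Real.sqrt_le_sqrt ?_
    have hrw : ∀ (a : TorusSite 1 (2 * (2 * M))) (b : TorusSite 2 L),
        (β / (2 * (2 * M) : ℕ) * |(((a 0).valMinAbs : ℤ) : ℝ)|) ^ 2 *
          (1 + c₀ * (4 * |(((a 0).valMinAbs : ℤ) : ℝ)| / (2 * (2 * M) : ℕ)) ^ (2 * 6) +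
            ∑ i : Fin 2, c₁ * (4 * |(((b i).valMinAbs : ℤ) : ℝ)| / L) ^ (2 * 2))⁻¹ =
        (β / (((2 * (2 * M) : ℕ) : ℝ) * s₀)) ^ 2 * ((s₀ * |(((a 0).valMinAbs : ℤ) : ℝ)|) ^ 2 *
          (1 + (s₀ * |(((a 0).valMinAbs : ℤ) : ℝ)|) ^ 12 + ∑ i : Fin 2, (s₁ * |(((b i).valMinAbs : ℤ) : ℝ)|) ^ 4)⁻¹) := by
      intro a b
      have hNne : ((2 * (2 * M) : ℕ) : ℝ) ≠ 0 := hNgpos.ne'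
      have hLne : (L : ℝ) ≠ 0 := hL.ne'
      have f0 : c₀ * (4 * |(((a 0).valMinAbs : ℤ) : ℝ)| / (2 * (2 * M) : ℕ)) ^ (2 * 6) = (s₀ * |(((a 0).valMinAbs : ℤ) : ℝ)|) ^ 12 := by
        rw [hc₀, show 2 * 6 = 12 from rfl, ← mul_pow]; congr 1; field_simp
      have f1 : ∀ i : Fin 2, c₁ * (4 * |(((b i).valMinAbs : ℤ) : ℝ)| / L) ^ (2 * 2) = (s₁ * |(((b i).valMinAbs : ℤ) : ℝ)|) ^ 4 := by
        intro i
        rw [hc₁, show 2 * 2 = 4 from rfl, ← mul_pow]; congr 1; field_simp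
      have f2 : (β / (2 * (2 * M) : ℕ) * |(((a 0).valMinAbs : ℤ) : ℝ)|) ^ 2 =
          (β / (((2 * (2 * M) : ℕ) : ℝ) * s₀)) ^ 2 * (s₀ * |(((a 0).valMinAbs : ℤ) : ℝ)|) ^ 2 := by
        rw [← mul_pow]; congr 1; field_simp
      rw [f0, f2, mul_assoc]
      simp only [f1]
    simp_rw [hrw, ← mul_sum]
    refine mul_le_mul_of_nonneg_left ?_ (sq_nonneg _)
    have hW := sum_timeMomentWeight_le (N := 2 * (2 * M)) (L := L) hs₀ (fun _ : Fin 2 => s₁) (fun _ => hs₁)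
    rw [Fin.prod_univ_two, ← sq] at hW
    simp_rw [← mul_sum] at hW
    exact hW
  · -- the Plancherel side: sup `1`, support `N_s`, sixth time and second axis differences
    refine Real.sqrt_le_sqrt ?_
    rw [pow_one]
    refine mul_le_mul_of_nonneg_left ?_ (by positivity)
    -- `Σ‖G‖² ≤ N_s`
    have hP0 : ∑ p : TorusSite 1 (2 * (2 * M)), ∑ p' : TorusSite 2 L, ‖G (p, p')‖ ^ 2 ≤ Nsupp := by
      rw [← Fintype.sum_prod_type (f := fun q : TorusSite 1 (2 * (2 * M)) × TorusSite 2 L => ‖G q‖ ^ 2)]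
      have h := sum_norm_sq_fwdDiff_iter_le G ((fun _ : Fin 1 => (1 : ZMod (2 * (2 * M)))), (0 : TorusSite 2 L)) 0 (hsupp ω)
        (B := 1) (fun x => by simpa using hsup x)
      simpa using h
    -- `Σ‖Δ_t⁶G‖² ≤ 7·N_s·A₆²`
    have hP6 : ∑ p : TorusSite 1 (2 * (2 * M)), ∑ p' : TorusSite 2 L,
        ‖((fwdDiff (fun _ : Fin 1 => (1 : ZMod (2 * (2 * M)))))^[6] (fun q => G (q, p'))) p‖ ^ 2 ≤ (6 + 1) * Nsupp * A₆ ^ 2 := by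
      have h := sum_norm_sq_fwdDiff_iter_le G ((fun _ : Fin 1 => (1 : ZMod (2 * (2 * M)))), (0 : TorusSite 2 L)) 6 (hsupp ω) (h₆ ω)
      rw [Fintype.sum_prod_type] at h
      refine le_of_eq_of_le ?_ h
      refine sum_congr rfl fun p _ => sum_congr rfl fun p' _ => ?_
      rw [fwdDiff_iter_prod_fst]
    -- `Σ‖Δ_{e_i}²G‖² ≤ 3·N_s·(4/(s₁L))⁴`
    have hP2 : ∀ i : Fin 2, ∑ p : TorusSite 1 (2 * (2 * M)), ∑ p' : TorusSite 2 L,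
        ‖((fwdDiff (Pi.single i (1 : ZMod L) : TorusSite 2 L))^[2] (fun b => G (p, b))) p'‖ ^ 2 ≤
          (2 + 1) * Nsupp * ((4 / (s₁ * L)) ^ 2) ^ 2 := by
      intro i
      have h := sum_norm_sq_fwdDiff_iter_le G ((0 : TorusSite 1 (2 * (2 * M))), (Pi.single i (1 : ZMod L) : TorusSite 2 L)) 2 (hsupp ω)
        (fun q => h₁ ω q i)
      rw [Fintype.sum_prod_type] at h
      refine le_of_eq_of_le ?_ h
      refine sum_congr rfl fun p _ => sum_congr rfl fun p' _ => ?_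
      rw [fwdDiff_iter_prod_snd]
    -- `c₁·(4/(s₁L))⁴ = 1`
    have hc₁val : c₁ * ((4 / (s₁ * L)) ^ 2) ^ 2 = 1 := by
      rw [hc₁, ← pow_mul, show 2 * 2 = 4 from rfl, ← mul_pow]
      have : s₁ * L / 4 * (4 / (s₁ * L)) = 1 := by field_simp
      rw [this, one_pow]
    have hNs0 : (0 : ℝ) ≤ Nsupp := Nat.cast_nonneg _
    calc ∑ p : TorusSite 1 (2 * (2 * M)), ∑ p' : TorusSite 2 L, ‖G (p, p')‖ ^ 2 +
          c₀ * ∑ p : TorusSite 1 (2 * (2 * M)), ∑ p' : TorusSite 2 L,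
            ‖((fwdDiff (fun _ : Fin 1 => (1 : ZMod (2 * (2 * M)))))^[6] (fun q => G (q, p'))) p‖ ^ 2 +
          ∑ i : Fin 2, c₁ * ∑ p : TorusSite 1 (2 * (2 * M)), ∑ p' : TorusSite 2 L,
            ‖((fwdDiff (Pi.single i (1 : ZMod L) : TorusSite 2 L))^[2] (fun b => G (p, b))) p'‖ ^ 2
        ≤ Nsupp + c₀ * ((6 + 1) * Nsupp * A₆ ^ 2) + ∑ _i : Fin 2, c₁ * ((2 + 1) * Nsupp * ((4 / (s₁ * L)) ^ 2) ^ 2) := by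
          gcongr with i
          exact hP2 i
      _ = Nsupp * (7 + 7 * (s₀ * ((2 * (2 * M) : ℕ) : ℝ) / 4) ^ 12 * A₆ ^ 2) := by
          rw [Fin.sum_univ_two, show c₁ * ((2 + 1) * (Nsupp : ℝ) * ((4 / (s₁ * L)) ^ 2) ^ 2) =
            (2 + 1) * Nsupp * (c₁ * ((4 / (s₁ * L)) ^ 2) ^ 2) by ring, hc₁val, hc₀]
          ring

end Summit.HubbardSuperconductivity.HubbardSuperconductivity.Theorems.EngineV8

end
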